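import Mathlib
import HarnessLib

/-!
# The `q`-van der Corput `A`-process (Polymath 8a, Proposition 4.12 (ii), first half of the proof)

Topic `Literature/NumberTheory/Sieve`, grouping namespace `Polymath8a`; a support file for the named
fact `Literature.NumberTheory.Sieve.mpz_of_lt` (**parity.S29**, `ParityWave0.lean`).  Source:
D. H. J. Polymath, *New equidistribution estimates of Zhang type*, Algebra & Number Theory 8:9 (2014)
2067–2199 = arXiv:1402.0811, §4.4, proof of **Proposition 4.12 (ii)** ("one van der Corput +
Ramanujan–Weil"), the `q`-van der Corput `A`-process of Heath-Brown and Graham–Ringrose, which is the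
source of the paper's improvement of Zhang's Type I/II numerology (Remark 4.14) and is used again, for
general periodic functions, in the advanced Type I estimate of §8 (Remark 4.14 (2)).  As printed, for
`q = rs`, `K = ⌊N/r⌋` and `e_q(f(n+kr)) = e_r(s̄ f(n)) e_s(r̄ f(n+kr))`:

"Using translation invariance, we can write `∑_n ψ_N(n) e_q(f(n)) = (1/K) ∑_n ∑_{k=1}^K ψ_N(n+kr) e_q(f(n+kr))`
… and hence we obtain
`|∑_n ψ_N(n) e_q(f(n))| ≤ (1/K) ∑_n |∑_{k=1}^K ψ_N(n+kr) e_s(r̄ f(n+kr))| ≪ (N^{1/2}/K) (∑_n |∑_{k=1}^K ψ_N(n+kr) e_s(r̄ f(n+kr))|²)^{1/2}`,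
where the factor `N^{1/2}` arises because the summand is (as a function of `n`) supported on an
interval of length `O(N)`. Expanding the square, we obtain
`|∑_n ψ_N(n) e_q(f(n))|² ≪ (N/K²) ∑_{1≤k,l≤K} A(k,l)`, where
`A(k,l) = ∑_n ψ_N(n+kr) \overline{ψ_N(n+lr)} e_s(r̄ (f(n+kr) − f(n+lr)))`."

This step uses nothing about `e_q(f(n))` except the factorisation into an `r`-periodic factor of
modulus `≤ 1` and a second factor, so we PROVE it in that generality (which is the form needed in §8):
for any weight `w : ℤ → ℂ` supported in an interval `(a, a + N]`, any `α : ℤ → ℂ` with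
`α(n + rm) = α(n)`, `|α| ≤ 1`, any `β : ℤ → ℂ` and any `K ≥ 1`,

* `Polymath8a.vanDerCorput_shift` — translation invariance and periodicity:
  `∑_n w(n) α(n) β(n) = ∑_n α(n) w(n+kr) β(n+kr)`;
* `Polymath8a.vanDerCorput_average` — `K ∑_n w(n)α(n)β(n) = ∑_n α(n) ∑_{k=1}^K w(n+kr) β(n+kr)`;
* `Polymath8a.vanDerCorput_A_process` — **the `A`-process inequality** with explicit constant:
  `|∑_n w(n) α(n) β(n)|² ≤ ((N + Kr)/K²) ∑_{1≤k,l≤K} |A(k,l)|`,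
  `A(k,l) = ∑_n w(n+kr) \overline{w(n+lr)} β(n+kr) \overline{β(n+lr)}` (the printed `≪ N/K²` being
  `(N + Kr)/K² ≤ 2N/K²` for `Kr ≤ N`);
* `Polymath8a.vanDerCorput_A_process_diag` — the same with the diagonal separated:
  `|∑_n w α β|² ≤ ((N + Kr)/K²) (∑_{k} |A(k,k)| + ∑_{k ≠ l} |A(k,l)|)`, ready for the diagonal bound
  `A(k,k) = ∑_n |w(n+kr)|² |β|² ≪ N` and the off-diagonal completion-of-sums estimates ((4.20)–(4.22)).

Everything is PROVED (theorems only; no definitions, no named facts): Cauchy–Schwarz on the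
`N + Kr` integers `n` carrying a non-zero summand, and expansion of the square.

## References

* D. H. J. Polymath, *New equidistribution estimates of Zhang type*, Algebra & Number Theory 8:9
  (2014) 2067–2199, arXiv:1402.0811: §4.4, Proposition 4.12 (ii) and its proof ((4.19)–(4.20)),
  Remark 4.14. [cite: Polymath8a2014, Proposition 4.12 (ii), proof]
* D. R. Heath-Brown, *Hybrid bounds for Dirichlet L-functions*, Invent. Math. 47 (1978) 149–170;
  S. W. Graham, C. J. Ringrose, *Lower bounds for least quadratic non-residues*, in: Analytic number
  theory (Allerton Park, IL, 1989), Progr. Math. 85 (1990) 269–309 (the `q`-van der Corput method;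
  the paper's references [heath-hybrid], [graham]).
-/

noncomputable section

open Finset
open scoped ComplexConjugate

namespace Literature.NumberTheory.Sieve

namespace Polymath8a

section AProcess

variable {w α β : ℤ → ℂ}

/-- Translation invariance of sums over `ℤ`: `∑_n F(n + t) = ∑_n F(n)`. [folklore] -/
theorem tsum_int_comp_add_right (F : ℤ → ℂ) (t : ℤ) : ∑' n : ℤ, F (n + t) = ∑' n : ℤ, F n :=
  (Equiv.addRight t).tsum_eq F

/-- If `w` is supported in `(a, a + N]`, `1 ≤ k ≤ K` and `w(n + kr) ≠ 0`, then
`n ∈ (a − Kr, a + N]`. [folklore] -/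
theorem mem_Ioc_of_shift_ne_zero {a : ℤ} {N : ℕ} (hw : ∀ n, w n ≠ 0 → n ∈ Finset.Ioc a (a + N))
    {r K k : ℕ} (hk : k ∈ Finset.Icc 1 K) {n : ℤ} (hn : w (n + k * r) ≠ 0) :
    n ∈ Finset.Ioc (a - K * r) (a + N) := by
  have h := hw _ hn
  rw [Finset.mem_Ioc] at h ⊢
  rw [Finset.mem_Icc] at hk
  have hkK : (k : ℤ) * r ≤ (K : ℤ) * r := by
    have : (k : ℤ) ≤ K := by exact_mod_cast hk.2
    exact mul_le_mul_of_nonneg_right this (by positivity)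
  have hkr : (0 : ℤ) ≤ k * r := by positivity
  constructor <;> linarith

/-- **Translation invariance + periodicity** (proof of Proposition 4.12 (ii): "Using translation
invariance, we can write …" and "since `q = rs`, `e_q(f(n+kr)) = e_r(s̄f(n)) e_s(r̄ f(n+kr))`"):
`∑_n w(n) α(n) β(n) = ∑_n α(n) w(n + kr) β(n + kr)` when `α(n + rm) = α(n)`.
[cite: Polymath8a2014, proof of Proposition 4.12 (ii)] -/
theorem vanDerCorput_shift {r : ℕ} (hα : ∀ n m : ℤ, α (n + r * m) = α n) (β : ℤ → ℂ) (w : ℤ → ℂ)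
    (k : ℕ) :
    ∑' n : ℤ, w n * α n * β n = ∑' n : ℤ, α n * (w (n + k * r) * β (n + k * r)) := by
  rw [← tsum_int_comp_add_right (fun n => w n * α n * β n) (k * r)]
  refine tsum_congr fun n => ?_
  rw [show n + (k : ℤ) * r = n + r * k by ring, hα n k]
  ring

/-- **Averaging over the shifts**: `K · ∑_n w(n) α(n) β(n) = ∑_n α(n) ∑_{k=1}^K w(n + kr) β(n + kr)`
(the display "`∑_n ψ_N(n) e_q(f(n)) = (1/K) ∑_n ∑_{k=1}^K ψ_N(n+kr) e_q(f(n+kr))`"), for `w`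
supported in `(a, a + N]`. [cite: Polymath8a2014, proof of Proposition 4.12 (ii)] -/
theorem vanDerCorput_average {a : ℤ} {N : ℕ} (hw : ∀ n, w n ≠ 0 → n ∈ Finset.Ioc a (a + N))
    {r : ℕ} (hα : ∀ n m : ℤ, α (n + r * m) = α n) (β : ℤ → ℂ) (K : ℕ) :
    (K : ℂ) * ∑' n : ℤ, w n * α n * β n =
      ∑' n : ℤ, α n * ∑ k ∈ Finset.Icc 1 K, w (n + k * r) * β (n + k * r) := by
  have hsumm : ∀ k ∈ Finset.Icc 1 K, Summable fun n : ℤ => α n * (w (n + k * r) * β (n + k * r)) := by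
    intro k hk
    refine summable_of_ne_finset_zero (s := Finset.Ioc (a - K * r) (a + N)) fun n hn => ?_
    have : w (n + k * r) = 0 := by
      by_contra h
      exact hn (mem_Ioc_of_shift_ne_zero hw hk h)
    rw [this, zero_mul, mul_zero]
  calc (K : ℂ) * ∑' n : ℤ, w n * α n * β n
      = ∑ k ∈ Finset.Icc 1 K, ∑' n : ℤ, w n * α n * β n := by
        rw [Finset.sum_const, Nat.card_Icc, nsmul_eq_mul]
        congr 1
    _ = ∑ k ∈ Finset.Icc 1 K, ∑' n : ℤ, α n * (w (n + k * r) * β (n + k * r)) :=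
        Finset.sum_congr rfl fun k _ => vanDerCorput_shift hα β w k
    _ = ∑' n : ℤ, ∑ k ∈ Finset.Icc 1 K, α n * (w (n + k * r) * β (n + k * r)) :=
        (Summable.tsum_finsetSum hsumm).symm
    _ = _ := tsum_congr fun n => by rw [Finset.mul_sum]

/-- Expansion of the square: `∑_{n ∈ T} |∑_k x_k(n)|² = ∑_{k,l} ∑_{n ∈ T} x_k(n) \overline{x_l(n)}`
(as complex numbers). [folklore] -/
theorem sum_norm_sq_sum_eq {ι : Type*} (T : Finset ℤ) (S : Finset ι) (x : ι → ℤ → ℂ) :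
    ((∑ n ∈ T, ‖∑ k ∈ S, x k n‖ ^ 2 : ℝ) : ℂ) =
      ∑ k ∈ S, ∑ l ∈ S, ∑ n ∈ T, x k n * conj (x l n) := by
  push_cast
  calc ∑ n ∈ T, ((‖∑ k ∈ S, x k n‖ : ℂ)) ^ 2
      = ∑ n ∈ T, (∑ k ∈ S, x k n) * conj (∑ l ∈ S, x l n) := by
        refine Finset.sum_congr rfl fun n _ => ?_
        rw [Complex.mul_conj, Complex.normSq_eq_norm_sq]
        push_cast
        ring
    _ = ∑ n ∈ T, ∑ k ∈ S, ∑ l ∈ S, x k n * conj (x l n) := by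
        refine Finset.sum_congr rfl fun n _ => ?_
        rw [map_sum, Finset.sum_mul_sum]
    _ = ∑ k ∈ S, ∑ n ∈ T, ∑ l ∈ S, x k n * conj (x l n) := Finset.sum_comm
    _ = _ := Finset.sum_congr rfl fun k _ => Finset.sum_comm

/-- **The `q`-van der Corput `A`-process** (Polymath 8a, proof of Proposition 4.12 (ii), (4.19)–(4.20);
Heath-Brown, Graham–Ringrose): for a weight `w : ℤ → ℂ` supported in an interval `(a, a + N]`, an
`r`-periodic `α` with `|α| ≤ 1` (`α(n + rm) = α(n)`), any `β : ℤ → ℂ` and `K ≥ 1`,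
`|∑_n w(n) α(n) β(n)|² ≤ ((N + Kr)/K²) ∑_{1 ≤ k, l ≤ K} |A(k, l)|`,
`A(k, l) = ∑_n w(n+kr) \overline{w(n+lr)} β(n+kr) \overline{β(n+lr)}` ("`|∑_n ψ_N(n) e_q(f(n))|² ≪ (N/K²) ∑_{1≤k,l≤K} A(k,l)`";
the printed `A(k,l) = ∑_n ψ_N(n+kr)\overline{ψ_N(n+lr)} e_s(r̄(f(n+kr) − f(n+lr)))` is the case
`w = ψ_N`, `α = e_r(s̄ f)`, `β = e_s(r̄ f)`).  The `α`-factor is discarded after the shift, the `n`-sum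
(over the `N + Kr` integers carrying a non-zero summand) is treated by Cauchy–Schwarz, and the
square is expanded. [cite: Polymath8a2014, Proposition 4.12 (ii), proof, (4.19)–(4.20)] -/
theorem vanDerCorput_A_process {a : ℤ} {N : ℕ} (hw : ∀ n, w n ≠ 0 → n ∈ Finset.Ioc a (a + N))
    {r : ℕ} (hα : ∀ n m : ℤ, α (n + r * m) = α n) (hα1 : ∀ n, ‖α n‖ ≤ 1) (β : ℤ → ℂ)
    {K : ℕ} (hK : 1 ≤ K) :
    ‖∑' n : ℤ, w n * α n * β n‖ ^ 2 ≤
      ((N : ℝ) + K * r) / (K : ℝ) ^ 2 * ∑ k ∈ Finset.Icc 1 K, ∑ l ∈ Finset.Icc 1 K,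
        ‖∑' n : ℤ, w (n + k * r) * conj (w (n + l * r)) * (β (n + k * r) * conj (β (n + l * r)))‖ := by
  set T : Finset ℤ := Finset.Ioc (a - K * r) (a + N) with hT
  have hTcard : (T.card : ℝ) = N + K * r := by
    rw [hT, Int.card_Ioc, show a + (N : ℤ) - (a - K * r) = ((N + K * r : ℕ) : ℤ) by push_cast; ring,
      Int.toNat_natCast]
    push_cast
    ring
  -- the shifted weights vanish off `T`
  have hwT : ∀ k ∈ Finset.Icc 1 K, ∀ n ∉ T, w (n + k * r) = 0 := by
    intro k hk n hn
    by_contra h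
    exact hn (mem_Ioc_of_shift_ne_zero hw hk h)
  set x : ℕ → ℤ → ℂ := fun k n => w (n + k * r) * β (n + k * r) with hx
  set G : ℤ → ℂ := fun n => ∑ k ∈ Finset.Icc 1 K, x k n with hG
  have hGT : ∀ n ∉ T, G n = 0 := by
    intro n hn
    simp only [hG, hx]
    exact Finset.sum_eq_zero fun k hk => by rw [hwT k hk n hn, zero_mul]
  set S : ℂ := ∑' n : ℤ, w n * α n * β n with hS
  -- Step 1: `K S = ∑_{n ∈ T} α(n) G(n)`
  have h1 : (K : ℂ) * S = ∑ n ∈ T, α n * G n := by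
    rw [hS, vanDerCorput_average hw hα β K]
    rw [tsum_eq_sum (s := T) (fun n hn => by simp only [hG, hx] at hGT ⊢; rw [hGT n hn, mul_zero])]
  -- Step 2: `K |S| ≤ ∑_{n ∈ T} |G n|`
  have h2 : (K : ℝ) * ‖S‖ ≤ ∑ n ∈ T, ‖G n‖ := by
    have : (K : ℝ) * ‖S‖ = ‖(K : ℂ) * S‖ := by rw [norm_mul, Complex.norm_natCast]
    rw [this, h1]
    refine (norm_sum_le _ _).trans (Finset.sum_le_sum fun n _ => ?_)
    rw [norm_mul]
    exact mul_le_of_le_one_left (norm_nonneg _) (hα1 n)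
  -- Step 3: Cauchy–Schwarz
  have h3 : ((K : ℝ) * ‖S‖) ^ 2 ≤ T.card * ∑ n ∈ T, ‖G n‖ ^ 2 :=
    (pow_le_pow_left₀ (by positivity) h2 2).trans (sq_sum_le_card_mul_sum_sq (s := T) (f := fun n => ‖G n‖))
  -- Step 4: expand the square
  have h4 : ∑ n ∈ T, ‖G n‖ ^ 2 ≤ ∑ k ∈ Finset.Icc 1 K, ∑ l ∈ Finset.Icc 1 K,
      ‖∑' n : ℤ, w (n + k * r) * conj (w (n + l * r)) * (β (n + k * r) * conj (β (n + l * r)))‖ := by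
    have hexp := sum_norm_sq_sum_eq T (Finset.Icc 1 K) x
    have hreal : ∑ n ∈ T, ‖G n‖ ^ 2 = ‖((∑ n ∈ T, ‖G n‖ ^ 2 : ℝ) : ℂ)‖ := by
      rw [Complex.norm_real, Real.norm_eq_abs, abs_of_nonneg (Finset.sum_nonneg fun _ _ => by positivity)]
    rw [hreal, hexp]
    refine (norm_sum_le _ _).trans (Finset.sum_le_sum fun k hk => ?_)
    refine (norm_sum_le _ _).trans (Finset.sum_le_sum fun l hl => le_of_eq ?_)
    congr 1
    rw [tsum_eq_sum (s := T) (fun n hn => by rw [hwT k hk n hn, zero_mul, zero_mul])]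
    refine Finset.sum_congr rfl fun n _ => ?_
    simp only [hx, map_mul]
    ring
  -- Step 5: assemble
  have hK0 : (0 : ℝ) < K := by exact_mod_cast hK
  rw [div_mul_eq_mul_div, le_div_iff₀ (by positivity), ← hTcard]
  calc ‖S‖ ^ 2 * (K : ℝ) ^ 2 = ((K : ℝ) * ‖S‖) ^ 2 := by ring
    _ ≤ T.card * ∑ n ∈ T, ‖G n‖ ^ 2 := h3
    _ ≤ _ := mul_le_mul_of_nonneg_left h4 (by positivity)

/-- **The `A`-process with the diagonal separated** ((4.20)–(4.21): "We have
`A(k,k) = ∑_n |ψ_N(n+kr)|² ≪ N (log N)^{O(1)}` and therefore `∑_{1≤k≤K} |A(k,k)| ≪ KN (log N)^{O(1)}`.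
There remains to handle the off-diagonal terms"): under the hypotheses of `vanDerCorput_A_process`,
if `|A(k,k)| ≤ X` for all `k` and `|A(k,l)| ≤ Y k l` for `k ≠ l`, then
`|∑_n w(n) α(n) β(n)|² ≤ ((N + Kr)/K²) (K X + ∑_{k ≠ l} Y k l)`.
[cite: Polymath8a2014, Proposition 4.12 (ii), proof, (4.20)–(4.21)] -/
theorem vanDerCorput_A_process_diag {a : ℤ} {N : ℕ} (hw : ∀ n, w n ≠ 0 → n ∈ Finset.Ioc a (a + N))
    {r : ℕ} (hα : ∀ n m : ℤ, α (n + r * m) = α n) (hα1 : ∀ n, ‖α n‖ ≤ 1) (β : ℤ → ℂ)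
    {K : ℕ} (hK : 1 ≤ K) {X : ℝ} {Y : ℕ → ℕ → ℝ}
    (hX : ∀ k ∈ Finset.Icc 1 K,
      ‖∑' n : ℤ, w (n + k * r) * conj (w (n + k * r)) * (β (n + k * r) * conj (β (n + k * r)))‖ ≤ X)
    (hY : ∀ k ∈ Finset.Icc 1 K, ∀ l ∈ Finset.Icc 1 K, k ≠ l →
      ‖∑' n : ℤ, w (n + k * r) * conj (w (n + l * r)) * (β (n + k * r) * conj (β (n + l * r)))‖ ≤ Y k l) :
    ‖∑' n : ℤ, w n * α n * β n‖ ^ 2 ≤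
      ((N : ℝ) + K * r) / (K : ℝ) ^ 2 * (K * X +
        ∑ k ∈ Finset.Icc 1 K, ∑ l ∈ (Finset.Icc 1 K).filter (fun l => k ≠ l), Y k l) := by
  refine (vanDerCorput_A_process hw hα hα1 β hK).trans (mul_le_mul_of_nonneg_left ?_ (by positivity))
  -- split each inner sum into `l = k` and `l ≠ k`
  have hsplit : ∀ k ∈ Finset.Icc 1 K, ∑ l ∈ Finset.Icc 1 K,
      ‖∑' n : ℤ, w (n + k * r) * conj (w (n + l * r)) * (β (n + k * r) * conj (β (n + l * r)))‖ ≤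
      X + ∑ l ∈ (Finset.Icc 1 K).filter (fun l => k ≠ l), Y k l := by
    intro k hk
    rw [← Finset.sum_filter_add_sum_filter_not (Finset.Icc 1 K) (fun l => k = l)]
    refine add_le_add ?_ (Finset.sum_le_sum fun l hl => ?_)
    · have : (Finset.Icc 1 K).filter (fun l => k = l) = {k} := by
        ext l; simp only [Finset.mem_filter, Finset.mem_Icc, Finset.mem_singleton]
        rw [Finset.mem_Icc] at hk; omega
      rw [this, Finset.sum_singleton]
      exact hX k hk
    · rw [Finset.mem_filter] at hl
      exact hY k hk l hl.1 hl.2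
  calc _ ≤ ∑ k ∈ Finset.Icc 1 K, (X + ∑ l ∈ (Finset.Icc 1 K).filter (fun l => k ≠ l), Y k l) :=
        Finset.sum_le_sum hsplit
    _ = _ := by
        rw [Finset.sum_add_distrib, Finset.sum_const, Nat.card_Icc, nsmul_eq_mul]
        push_cast
        ring

end AProcess

end Polymath8a

end Literature.NumberTheory.Sieve
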